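import Literature.MathematicalPhysics.QuantumFieldTheory.Balaban1983to89.B9Thm311FlatLettersTower
import Literature.MathematicalPhysics.QuantumFieldTheory.Balaban1983to89.B9Eq364GreenLipschitzFormTower
import Literature.MathematicalPhysics.QuantumFieldTheory.Balaban1983to89.B9Eq319QprimeTowerLipschitzL2
import Literature.MathematicalPhysics.QuantumFieldTheory.Balaban1983to89.B9Eq373DerivativeRemainderL2
import Literature.MathematicalPhysics.QuantumFieldTheory.Balaban1983to89.B9Eq384RemainderLetters

/-!
# `Balaban1983to89.B9Thm311SitePrimeFormCoerciveTowerCanonical` — T. Bałaban, *Propagators for lattice gauge theories in a background field*, Commun.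
# Math. Phys. **99** (1985) 389–434 [Balaban1985BackgroundPropagators] (3.24)–(3.25) p. 394, (3.35) p. 396, (3.63)–(3.64) p. 402, Thm 3.11 p. 416, with
# [Balaban1984PropagatorsI] (1.18) p. 20: **THE STRONG SITE COERCIVITY OF THE `k`-LEVEL OPERATOR `Δ′_{a′,k}(U) = Δ^η_U + a′Q̃′_k(U)†Q̃′_k(U)` AT A
# NEAR-FLAT BACKGROUND, LETTERS DISCHARGED ALONG BAŁABAN's NORMALISATION** — `(1∕(2 + 2∕a′) − θ′_k)·(‖D_1λ‖² + (ηL^{n+1})⁻²‖λ‖²) ≤ re⟨λ, Δ′_{a′,k}(U)λ⟩`,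
# `θ′_k = √d·Kα + d·K²α² + a′ρ_k s(2s + ρ_k s)`, `K = 2M_φM_φ′`, `s = (ηL^{n+1})⁻¹`, `ρ_k = Π_{j≤n}(1 + Kε_j)^{d(L−1)} − 1`; on print's diagonal under the
# profile `ε_j ≤ αr^j` every constant is a closed function of `(d, a′, K, L, r, α)` — no `η`, `m`, `c₀`, `c₁`, no level count — and `∃ α₀ γ′ > 0` BEFORE
# every lattice ∕ height ∕ volume ∕ background binder: the `k`-level twin of `B9Thm311SitePrimeFormCoerciveCanonical` (R2′ STEP B7′ S3b, one storey up)

statement-level skeleton of published theorems with citation tags; proofs where landed; nothing here is a claim about the Yang–Mills mass gap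

CITATION HEADER (lean-in-tree rule).  Audit cell `pub-balaban`, sub-cell `t4`, BINDER row NE9; filed by NE9 formalisation-swarm leaf prover 03
(`b2b-balaban-t4-ne9-formalise-leaf-03`, gen 64) on the row OWNER's offer (t4-ne9-p1 gen 85, «ROUTE G ONE STOREY UP», W-3 «the k-level twin of
`B9Thm311SitePrimeFormCoerciveCanonical`»).  Source READ in the held text: [Balaban1985BackgroundPropagators] pp. 394–396, 402–403, 416
(`paper:balaban1985-cmp99-background-propagators`, journal page = PDF page + 388).
THE PRINT (verbatim).  p. 394 (3.24): *«Δ′_a = Δ′_a(U) = D*_U D_U + Q′* a Q′, a > 0»*; (3.25): *«G′ = G′(U) = (Δ′_a)⁻¹»*.  p. 396 (3.35): *«there exists a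
gauge transformation u on □ such that U^u = e^{iηA} …»* (the small-field class).  p. 402 (3.63)–(3.64): *«Δ′_a(U′U) = Δ′_a(U) − V′(A) … G′(U′U) =
G′(U)(I − V′(A)G′(U))⁻¹»*.  Thm 3.11 p. 416: *«Δ′_a, G′, (Q′G′²Q′*)⁻¹, Δ_a, G are positive definite».*  [Balaban1984PropagatorsI] (1.18) p. 20: *«a composition
of k transformations … is again a transformation of the same type with L replaced by L^k»*.

WHY (R2′ STEP B7′ S3 one storey up, «letters in, numbers out»).  The one-step `B9Thm311SitePrimeFormCoerciveCanonical.strong_site_coercive_canonical` is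
the `γ` letter of print's projection road (3.25); its `k`-level twin for the composite averaging `Q′_k(U)` ((3.15)∕(3.19)) composes THREE IMPORTED pieces:
the flat strong coercivity AT BLOCK SIZE `L^{n+1}` (owner's `B9Thm311FlatLettersTower.flat_site_strong_coercive_tower`), the form-relative near-flat step
(ne9-leaf-04's `B9Eq364GreenLipschitzFormTower.re_inner_laplacePrimeAk_ge_flat_sub` — this lineage's one-step lemma one storey up, consumed BY NAME), and the
letters `δ_D = √d·‖η⁻¹‖·2M_φM_φ′αη = √d·Kα` (`B9Eq373DerivativeRemainderL2.norm_covDerivL2K_sub_le` + `B9Eq384RemainderLetters.norm_adTransportW_sub_le`;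
η-free on the whole slab), `δ_Q = ρ_k·s`, `M_Q = s` (ne9-leaf-02's `B9Eq319QprimeTowerLipschitzL2.norm_QtildeTower_sub_flat_le` ∕ `…_one_le`).
WHAT IS PROVED (sorry-free; proof lane — 0 `def`, no `Prop` placeholder; [folklore] real arithmetic on landed letters).
* §1 **`strong_site_coercive_tower_of_letters`** — ABSTRACT: flat strong coercivity `γ_f·(‖D_1λ‖² + s²‖λ‖²)` displayed at `1 ≤ s`, letters `δ_D, δ_Q, M_Q`
  displayed ⇒ `(γ_f − (δ_D + δ_D² + a′δ_Q(2M_Q + δ_Q)))·(‖D_1λ‖² + s²‖λ‖²) ≤ re⟨λ, Δ′_{a′,k}(U)λ⟩` — the STRONG currency (gradient row KEPT; ne9-leaf-04's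
  `coercive_laplacePrimeAk_of_letters` is the `‖λ‖²`-row reading at `s = 1`).
* §2 **`strong_site_coercive_tower_canonical`** — on the SLAB `0 < ηL^{n+1} ≤ 1` along `c₁(ηL^{n+1})² = c₀(L^{n+1})^d`, fine bonds `‖U(b) − 1‖ ≤ αη` in `U1`
  ((3.35)), mutually adjoint transporters, level averages `‖Ū^j(b) − 1‖ ≤ ε_j` in `U1`: the title's inequality, EVERY letter discharged.
* §3 **`strong_site_coercive_tower_diagonal`** (`ηL^{n+1} = 1`), **`…_diagonal_geometric`** (`ε_j ≤ αr^j`: `ρ_k ≤ exp(d(L−1)Kα∕(1−r)) − 1`, NO level count),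
  `coercive_laplacePrimeAk_diagonal_geometric` (`‖λ‖²` row), `laplacePrimeAk_pos_diagonal_geometric` (the `hpos′` slot of `B9Eq324DeltaPrimeATower.GpOfUk`
  DISCHARGED at every height in the window `θ⋆(α) < 1∕(2+2∕a′)`).
* §4 **`exists_strong_site_coercive_tower_diagonal`** — THE (SC)-SHAPE FOR THE SITE OPERATOR AT `k` LEVELS: `∃ α₀ γ′ > 0` (closed forms in
  `(d, a′, K, L, r)`) BEFORE `∀ n η c₀ c₁ m U α ε λ`: `γ′·(‖D_1λ‖² + ‖λ‖²) ≤ re⟨λ, Δ′_{a′,k}(U)λ⟩` — NO displayed letter; the site-operator companion of the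
  owner's `B9Thm311SmallFieldCoercivityTowerDiagonal.exists_strong_coercive_tower_diagonal` (bond operator, `R`-letter displayed there).
MODEL ∕ HONEST SCOPE.  (M1) [folklore] composition + threshold arithmetic; this file adds the strong packaging, the slab, the discharge and the `∃`.
(M2) DISPLAYED, NOT discharged: `hRS` (unitarity of the transporters), the profile `ε_j` and the window `‖U − 1‖ ≤ αη` (print's running small-field
axioms (3.35)–(3.37) ∕ Lemma 3.1 — the gauge question), `U, Ū^j ∈ U1`.  (M3) NOT the bond operator `Δ_a(U)` ((SC-k), the owner's files), NOT `G′_k`'s decay,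
NOT the `R`-letter (ne9-leaf-04's `B9Eq325RLipschitzSqrtTowerDiagonal`), NOT Lemma 3.1.  «NE9 ⇐ the named binders»; NE9 NOT PRINTED ∕ NOT PROVED; NOT
summit progress (cell pub-balaban: spine PROVED 0/9; rung (B)+1 finite T⁴ — NOT infinite volume, NOT mass gap, NOT Clay; HONEST DEPENDENCY: continuum YM
on T⁴ ⇐ BetaPertH ∧ nine spine estimates (0/9 proved); BetaPertH ⇐ (D1) ∧ (D4) ∧ CAP+tail; G-an2-4 gates asym, D1 and NE2/3/4).  Unit
`b2b-balaban-t4-ne9-formalise-leaf-03` (gen 64); NEW file; modifies nothing.  Net new unproved facts: 0.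
-/

noncomputable section

open scoped BigOperators InnerProductSpace ComplexConjugate

namespace Literature.MathematicalPhysics.QuantumFieldTheory.Balaban1983to89.B9Thm311SitePrimeFormCoerciveTowerCanonical

open B4Sect5Torus (TSite)
open B9SectCLatticeCarrier (Bond)
open B7Prop1Explicit (U1)
open B9Eq311L2Pairing (WL2)
open B11Eq103H1Complex (SiteL2K covDerivL2K)
open B9Eq310HessianOperator (adTransportW)
open B9Eq315QTower (towerP UlevOf)
open B9Eq326OperatorTower (QprimeTowerW)
open B5Eq172HodgePositivity (adTransportW_one hRS_one)
open B9Eq324DeltaPrimeATower (laplacePrimeAk laplacePrimeAk_pos_of_coercive')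
open B9Thm311FlatLettersTower (flat_site_strong_coercive_tower)
open B9Eq364GreenLipschitzFormTower (re_inner_laplacePrimeAk_ge_flat_sub)
open B9Eq319QprimeTowerLipschitzL2 (norm_QtildeTower_sub_flat_le norm_QtildeTower_one_le)
open B9Eq373DerivativeRemainderL2 (norm_covDerivL2K_sub_le)
open B9Eq384RemainderLetters (norm_adTransportW_sub_le)

variable {d : ℕ} (L : ℕ) [NeZero L] (m : Fin d → ℕ) [∀ i, NeZero (m i)] (n : ℕ)
  {𝔸 : Type*} [NormedRing 𝔸] [NormedAlgebra ℂ 𝔸] [CompleteSpace 𝔸] [NormOneClass 𝔸]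
  {W : Type*} [NormedAddCommGroup W] [InnerProductSpace ℂ W] [FiniteDimensional ℂ W] (φ : W ≃ₗ[ℂ] 𝔸)
  (c₀ : ℝ) [Fact (0 < c₀)] (η : ℝ) (c₁ : ℝ) [Fact (0 < c₁)] {a' : ℝ}
  (U : Bond d (towerP L m (n + 1)) → 𝔸ˣ)
  (hRS : ∀ (b : Bond d (towerP L m (n + 1))) (v u : W), ⟪adTransportW φ U b v, u⟫_ℂ = ⟪v, adTransportW φ (fun b => (U b)⁻¹) b u⟫_ℂ)

/-! ## §1 The strong packaging, abstract in the letters -/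

section Letters

variable {δD δQ MQ γf s : ℝ} (ha' : 0 ≤ a') (hδD : 0 ≤ δD) (hδQ : 0 ≤ δQ) (hMQ : 0 ≤ MQ) (hs : 1 ≤ s)
  (hD : ∀ l : SiteL2K ℂ d (towerP L m (n + 1)) c₀ W, ‖covDerivL2K ℂ c₀ ((η : ℂ))⁻¹ (adTransportW φ U) l -
    covDerivL2K ℂ c₀ ((η : ℂ))⁻¹ (adTransportW φ (fun _ : Bond d (towerP L m (n + 1)) => (1 : 𝔸ˣ))) l‖ ≤ δD * ‖l‖)
  (hQ : ∀ l : SiteL2K ℂ d (towerP L m (n + 1)) c₀ W,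
    ‖((WL2.linearEquiv ℂ ℂ (fun _ : TSite d m => c₁)).symm.toLinearMap ∘ₗ QprimeTowerW L m n φ U (c₀ := c₀)) l -
      ((WL2.linearEquiv ℂ ℂ (fun _ : TSite d m => c₁)).symm.toLinearMap ∘ₗ
        QprimeTowerW L m n φ (fun _ : Bond d (towerP L m (n + 1)) => (1 : 𝔸ˣ)) (c₀ := c₀)) l‖ ≤ δQ * ‖l‖)
  (hQ₁ : ∀ l : SiteL2K ℂ d (towerP L m (n + 1)) c₀ W,
    ‖((WL2.linearEquiv ℂ ℂ (fun _ : TSite d m => c₁)).symm.toLinearMap ∘ₗ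
        QprimeTowerW L m n φ (fun _ : Bond d (towerP L m (n + 1)) => (1 : 𝔸ˣ)) (c₀ := c₀)) l‖ ≤ MQ * ‖l‖)
  (hflat : ∀ l : SiteL2K ℂ d (towerP L m (n + 1)) c₀ W,
    γf * (‖covDerivL2K ℂ c₀ ((η : ℂ))⁻¹ (adTransportW φ (fun _ : Bond d (towerP L m (n + 1)) => (1 : 𝔸ˣ))) l‖ ^ 2 + s ^ 2 * ‖l‖ ^ 2) ≤
      RCLike.re ⟪l, laplacePrimeAk L m n φ η (fun _ : Bond d (towerP L m (n + 1)) => (1 : 𝔸ˣ)) a' (c₁ := c₁) l⟫_ℂ)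

omit [NormOneClass 𝔸] in
include hRS ha' hδD hδQ hMQ hs hD hQ hQ₁ hflat in
/-- **THE STRONG SITE COERCIVITY OF `Δ′_{a′,k}(U)` FROM LETTERS** — flat STRONG coercivity `γ_f·(‖D_1λ‖² + s²‖λ‖²) ≤ re⟨λ, Δ′_{a′,k}(1)λ⟩` DISPLAYED at
a scale factor `1 ≤ s` ((3.16): `s = (ηL^{n+1})⁻¹`), letters `δ_D`, `δ_Q`, `M_Q` DISPLAYED: `(γ_f − (δ_D + δ_D² + a′δ_Q(2M_Q + δ_Q)))·(‖D_1λ‖² + s²‖λ‖²) ≤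
re⟨λ, Δ′_{a′,k}(U)λ⟩` — the near-flat form step (ne9-leaf-04's `re_inner_laplacePrimeAk_ge_flat_sub`, BY NAME) loses `δ_D‖D_1λ‖² + θ‖λ‖²`; `δ_D ≤ θ` and
`1 ≤ s²` move both losses into the scaled strong row; the GRADIENT ROW IS KEPT. [cite: Balaban1985BackgroundPropagators, (3.24) p.394, (3.63)–(3.64) p.402, Thm 3.11 p.416] -/
theorem strong_site_coercive_tower_of_letters (lam : SiteL2K ℂ d (towerP L m (n + 1)) c₀ W) :
    (γf - (δD + δD ^ 2 + a' * δQ * (2 * MQ + δQ))) *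
        (‖covDerivL2K ℂ c₀ ((η : ℂ))⁻¹ (adTransportW φ (fun _ : Bond d (towerP L m (n + 1)) => (1 : 𝔸ˣ))) lam‖ ^ 2 + s ^ 2 * ‖lam‖ ^ 2) ≤
      RCLike.re ⟪lam, laplacePrimeAk L m n φ η U a' (c₁ := c₁) lam⟫_ℂ := by
  have hnear := re_inner_laplacePrimeAk_ge_flat_sub L m n φ c₀ η U c₁ a' hRS ha' hδD hδQ hD hQ hQ₁ lam
  have hf := hflat lam
  set θ : ℝ := δD + δD ^ 2 + a' * δQ * (2 * MQ + δQ) with hθ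
  set D : ℝ := ‖covDerivL2K ℂ c₀ ((η : ℂ))⁻¹ (adTransportW φ (fun _ : Bond d (towerP L m (n + 1)) => (1 : 𝔸ˣ))) lam‖ ^ 2 with hDdef
  set X : ℝ := ‖lam‖ ^ 2 with hXdef
  have hX0 : 0 ≤ X := sq_nonneg _
  have hθD : δD ≤ θ := by rw [hθ]; linarith [(by positivity : 0 ≤ δD ^ 2 + a' * δQ * (2 * MQ + δQ))]
  -- the two absorptions `δ_D·D ≤ θ·D`, `θ·X ≤ θ·s²X`
  have h1 : δD * D ≤ θ * D := mul_le_mul_of_nonneg_right hθD (sq_nonneg _)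
  have h2 : θ * X ≤ θ * (s ^ 2 * X) := mul_le_mul_of_nonneg_left (le_mul_of_one_le_left hX0 (by nlinarith)) (hδD.trans hθD)
  rw [show (γf - θ) * (D + s ^ 2 * X) = γf * (D + s ^ 2 * X) - θ * D - θ * (s ^ 2 * X) by ring]
  linarith [hnear, hf, h1, h2]

end Letters

/-! ## §2 The letters discharged along Bałaban's normalisation on the slab `0 < ηL^{n+1} ≤ 1` -/

section Canonical

variable {Mφ Mφ' : ℝ} (hMφ : 0 ≤ Mφ) (hMφ' : 0 ≤ Mφ') (hφ : ∀ w, ‖φ w‖ ≤ Mφ * ‖w‖) (hφ' : ∀ X, ‖φ.symm X‖ ≤ Mφ' * ‖X‖)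
  (ha' : 0 < a') {α : ℝ} (hα : 0 ≤ α) (hUb : ∀ b, U b ∈ U1 𝔸) (hUε : ∀ b, ‖(U b : 𝔸) - 1‖ ≤ α * η)
  (εU : ℕ → ℝ) (hεU : ∀ j, 0 ≤ εU j)
  (hLε : ∀ (j : ℕ) (b : Bond d (towerP L m (j + 1))), ‖(UlevOf L m (n + 1) U j b : 𝔸) - 1‖ ≤ εU j)
  (hLb : ∀ (j : ℕ) (b : Bond d (towerP L m (j + 1))), UlevOf L m (n + 1) U j b ∈ U1 𝔸)

omit [NeZero L] [∀ i, NeZero (m i)] [CompleteSpace 𝔸] [FiniteDimensional ℂ W] [Fact (0 < c₁)] in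
include hMφ hMφ' hφ hφ' hα hUb hUε in
/-- **THE DERIVATIVE DEFECT IS η-FREE IN PRINT's SCALED WINDOW, ON THE WHOLE SLAB**: for `0 < η` and fine bonds `‖U(b) − 1‖ ≤ αη` in `U1`,
`‖D_Uλ − D_1λ‖ ≤ √d·(2M_φM_φ′)·α·‖λ‖` (`norm_adTransportW_sub_le` + `norm_covDerivL2K_sub_le`, `‖η⁻¹‖η = 1`; cf. ne9-leaf-04's
`norm_covDerivL2K_sub_flat_le_diagonal`, the same reading at `ηL^{n+1} = 1`). [cite: Balaban1985BackgroundPropagators, (3.35) p.396, (3.70)–(3.71) pp.404–405] -/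
theorem norm_covDerivL2K_sub_flat_le_of_window (hη0 : 0 < η) (lam : SiteL2K ℂ d (towerP L m (n + 1)) c₀ W) :
    ‖covDerivL2K ℂ c₀ ((η : ℂ))⁻¹ (adTransportW φ U) lam -
        covDerivL2K ℂ c₀ ((η : ℂ))⁻¹ (adTransportW φ (fun _ : Bond d (towerP L m (n + 1)) => (1 : 𝔸ˣ))) lam‖ ≤
      (Real.sqrt d * (2 * Mφ * Mφ') * α) * ‖lam‖ := by
  have hεR : 0 ≤ 2 * Mφ * Mφ' * (α * η) := by positivity
  have hR : ∀ (b : Bond d (towerP L m (n + 1))) (w : W), ‖adTransportW φ U b w - w‖ ≤ 2 * Mφ * Mφ' * (α * η) * ‖w‖ :=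
    fun b w => norm_adTransportW_sub_le φ hφ hφ' hMφ' U b (hUb b) (hUε b) w
  have hR₁ : ∀ (b : Bond d (towerP L m (n + 1))) (w : W), adTransportW φ (fun _ : Bond d (towerP L m (n + 1)) => (1 : 𝔸ˣ)) b w = w :=
    fun b w => by rw [adTransportW_one]; rfl
  have h := norm_covDerivL2K_sub_le (((η : ℂ))⁻¹) hεR hR hR₁ lam
  have hηinv : ‖((η : ℂ))⁻¹‖ * η = 1 := by
    rw [norm_inv, Complex.norm_real, Real.norm_eq_abs, abs_of_pos hη0, inv_mul_cancel₀ hη0.ne']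
  calc _ ≤ ‖((η : ℂ))⁻¹‖ * (2 * Mφ * Mφ' * (α * η)) * Real.sqrt d * ‖lam‖ := h
    _ = (Real.sqrt d * (2 * Mφ * Mφ') * α) * (‖((η : ℂ))⁻¹‖ * η) * ‖lam‖ := by ring
    _ = (Real.sqrt d * (2 * Mφ * Mφ') * α) * ‖lam‖ := by rw [hηinv, mul_one]

omit [NeZero L] in
/-- `0 ≤ ρ_k = Π_{j≤n}(1 + Kε_j)^{d(L−1)} − 1` for `K, ε_j ≥ 0`. [folklore] [cite: Balaban1985BackgroundPropagators, (3.19) p.393, p.403] -/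
theorem rhoTower_nonneg {K : ℝ} (hK : 0 ≤ K) (εU : ℕ → ℝ) (hεU : ∀ j, 0 ≤ εU j) (p : ℕ) :
    0 ≤ (∏ j ∈ Finset.range (n + 1), (1 + K * εU j) ^ p) - 1 :=
  sub_nonneg.2 (Finset.one_le_prod (s := Finset.range (n + 1)) fun j _ =>
    one_le_pow₀ (by linarith [mul_nonneg hK (hεU j)]))

include hRS hMφ hMφ' hφ hφ' ha' hα hUb hUε hεU hLε hLb in
/-- **THE STRONG SITE COERCIVITY OF THE `k`-LEVEL OPERATOR AT A NEAR-FLAT BACKGROUND, ALONG BAŁABAN's NORMALISATION** (`c₁(ηL^{n+1})² = c₀(L^{n+1})^d`,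
`0 < ηL^{n+1} ≤ 1`; fine bonds `‖U(b) − 1‖ ≤ αη` in `U1`, mutually adjoint transporters, level averages `‖Ū^j(b) − 1‖ ≤ ε_j` in `U1`): with `K := 2M_φM_φ′`,
`s := (ηL^{n+1})⁻¹`, `ρ_k := Π_{j≤n}(1 + Kε_j)^{d(L−1)} − 1`: `(1∕(2 + 2∕a′) − θ′_k)·(‖D_1λ‖² + s²‖λ‖²) ≤ re⟨λ, Δ′_{a′,k}(U)λ⟩`, `θ′_k = √d·Kα + (√d·Kα)² +
a′·ρ_k s·(2s + ρ_k s)` — §1 with `γ_f = 1∕(2+2∕a′)` (owner's `flat_site_strong_coercive_tower`), `δ_D = √d·Kα`, `δ_Q = ρ_k s`, `M_Q = s` (ne9-leaf-02's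
`norm_QtildeTower_sub_flat_le` ∕ `…_one_le`, `√(c₁∕(c₀L^{(n+1)d})) = s`); the one-step `strong_site_coercive_canonical` verbatim one storey up.
[cite: Balaban1985BackgroundPropagators, (3.24)–(3.25) p.394, (3.35) p.396, (3.63)–(3.64) p.402, Thm 3.11 p.416; Balaban1984PropagatorsI, (1.18) p.20] -/
theorem strong_site_coercive_tower_canonical (hηL0 : 0 < η * (L : ℝ) ^ (n + 1)) (hηL1 : η * (L : ℝ) ^ (n + 1) ≤ 1)
    (hs : c₁ * (η * (L : ℝ) ^ (n + 1)) ^ 2 = c₀ * ((L : ℝ) ^ (n + 1)) ^ d) (lam : SiteL2K ℂ d (towerP L m (n + 1)) c₀ W) :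
    (1 / (2 + 2 / a') -
        (Real.sqrt d * (2 * Mφ * Mφ') * α + (Real.sqrt d * (2 * Mφ * Mφ') * α) ^ 2 +
          a' * (((∏ j ∈ Finset.range (n + 1), (1 + 2 * Mφ * Mφ' * εU j) ^ (d * (L - 1))) - 1) * (η * (L : ℝ) ^ (n + 1))⁻¹) *
            (2 * (η * (L : ℝ) ^ (n + 1))⁻¹ +
              ((∏ j ∈ Finset.range (n + 1), (1 + 2 * Mφ * Mφ' * εU j) ^ (d * (L - 1))) - 1) * (η * (L : ℝ) ^ (n + 1))⁻¹))) *
        (‖covDerivL2K ℂ c₀ ((η : ℂ))⁻¹ (adTransportW φ (fun _ : Bond d (towerP L m (n + 1)) => (1 : 𝔸ˣ))) lam‖ ^ 2 +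
          ((η * (L : ℝ) ^ (n + 1))⁻¹) ^ 2 * ‖lam‖ ^ 2) ≤
      RCLike.re ⟪lam, laplacePrimeAk L m n φ η U a' (c₁ := c₁) lam⟫_ℂ := by
  have hc₀ : 0 < c₀ := Fact.out
  have hc₁ : 0 < c₁ := Fact.out
  have hη0 : 0 < η := pos_of_mul_pos_left hηL0 (pow_pos (by exact_mod_cast Nat.pos_of_ne_zero (NeZero.ne L)) _).le
  -- the weight factor `√(c₁/(c₀L^{(n+1)d})) = (ηL^{n+1})⁻¹`
  have hratio : Real.sqrt (c₁ / (c₀ * ((L : ℝ) ^ (n + 1)) ^ d)) = (η * (L : ℝ) ^ (n + 1))⁻¹ := by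
    rw [show c₁ / (c₀ * ((L : ℝ) ^ (n + 1)) ^ d) = ((η * (L : ℝ) ^ (n + 1))⁻¹) ^ 2 by rw [← hs]; field_simp, Real.sqrt_sq (by positivity)]
  -- the three letters
  have hDl := norm_covDerivL2K_sub_flat_le_of_window L m n φ c₀ η U hMφ hMφ' hφ hφ' hα hUb hUε hη0
  have hQl := fun l : SiteL2K ℂ d (towerP L m (n + 1)) c₀ W =>
    norm_QtildeTower_sub_flat_le L m n φ hMφ hMφ' hφ hφ' (c₀ := c₀) c₁ U εU hεU hLε hLb l
  have hQ1 := fun l : SiteL2K ℂ d (towerP L m (n + 1)) c₀ W => norm_QtildeTower_one_le L m n φ (c₀ := c₀) c₁ (𝔸 := 𝔸) l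
  simp only [hratio] at hQl hQ1
  have hflat := flat_site_strong_coercive_tower L m n φ c₀ η c₁ hη0.ne' ha' hηL0 hs
  have hρ := rhoTower_nonneg n (by positivity : 0 ≤ 2 * Mφ * Mφ') εU hεU (d * (L - 1))
  have hs0 : (0 : ℝ) ≤ (η * (L : ℝ) ^ (n + 1))⁻¹ := by positivity
  exact strong_site_coercive_tower_of_letters L m n φ c₀ η c₁ U hRS ha'.le (by positivity) (mul_nonneg hρ hs0) hs0
    (one_le_inv_iff₀.mpr ⟨hηL0, hηL1⟩) hDl hQl hQ1 hflat lam

/-! ## §3 Print's diagonal `ηL^{n+1} = 1`, and the geometric profile: no `η`, `m`, `c₀`, `c₁`, no level count -/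

include hRS hMφ hMφ' hφ hφ' ha' hα hUb hUε hεU hLε hLb in
/-- **ON PRINT's DIAGONAL `ηL^{n+1} = 1`, `c₀(L^{n+1})^d = c₁`**: `(1∕(2 + 2∕a′) − θ′_k)·(‖D_1λ‖² + ‖λ‖²) ≤ re⟨λ, Δ′_{a′,k}(U)λ⟩` with
`θ′_k = √d·Kα + (√d·Kα)² + a′ρ_k(2 + ρ_k)`, `ρ_k = Π_{j≤n}(1 + Kε_j)^{d(L−1)} − 1`, `K = 2M_φM_φ′` — a closed function of `(d, a′, K, L, α, ε_0, …, ε_n)`: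
NO `η`, NO period `m`, NO `c₀, c₁`. [cite: Balaban1985BackgroundPropagators, (3.24) p.394, (3.16) p.393, (3.35) p.396, Thm 3.11 p.416] -/
theorem strong_site_coercive_tower_diagonal (hηL : η * (L : ℝ) ^ (n + 1) = 1) (hw : c₀ * ((L : ℝ) ^ (n + 1)) ^ d = c₁)
    (lam : SiteL2K ℂ d (towerP L m (n + 1)) c₀ W) :
    (1 / (2 + 2 / a') -
        (Real.sqrt d * (2 * Mφ * Mφ') * α + (Real.sqrt d * (2 * Mφ * Mφ') * α) ^ 2 +
          a' * ((∏ j ∈ Finset.range (n + 1), (1 + 2 * Mφ * Mφ' * εU j) ^ (d * (L - 1))) - 1) *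
            (2 + ((∏ j ∈ Finset.range (n + 1), (1 + 2 * Mφ * Mφ' * εU j) ^ (d * (L - 1))) - 1)))) *
        (‖covDerivL2K ℂ c₀ ((η : ℂ))⁻¹ (adTransportW φ (fun _ : Bond d (towerP L m (n + 1)) => (1 : 𝔸ˣ))) lam‖ ^ 2 + ‖lam‖ ^ 2) ≤
      RCLike.re ⟪lam, laplacePrimeAk L m n φ η U a' (c₁ := c₁) lam⟫_ℂ := by
  have hηL0 : 0 < η * (L : ℝ) ^ (n + 1) := by rw [hηL]; exact one_pos
  have hs : c₁ * (η * (L : ℝ) ^ (n + 1)) ^ 2 = c₀ * ((L : ℝ) ^ (n + 1)) ^ d := by rw [hηL, one_pow, mul_one, hw]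
  have key := strong_site_coercive_tower_canonical L m n φ c₀ η c₁ U hRS hMφ hMφ' hφ hφ' ha' hα hUb hUε εU hεU hLε hLb hηL0 hηL.le hs lam
  simp only [hηL, inv_one, one_pow, one_mul, mul_one] at key
  exact key

omit [NeZero L] in
/-- **THE PROFILE BOUND**: under `ε_j ≤ αr^j` (`j ≤ n`, `0 ≤ r < 1`, `0 ≤ α`, `0 ≤ K`),
`Π_{j≤n}(1 + Kε_j)^p − 1 ≤ exp(p·Kα∕(1−r)) − 1` — `1 + x ≤ eˣ` per factor and the geometric sum; NO level count. [folklore]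
[cite: Balaban1985BackgroundPropagators, (3.37) p.396, (3.79)–(3.81) p.406; Balaban1985Averaging, Prop. 2 (52)–(54) p.26] -/
theorem rhoTower_le_exp_sub_one {K r α : ℝ} (hK : 0 ≤ K) (hr0 : 0 ≤ r) (hr1 : r < 1) (hα : 0 ≤ α) (εU : ℕ → ℝ) (hεU : ∀ j, 0 ≤ εU j)
    (hεg : ∀ j < n + 1, εU j ≤ α * r ^ j) (p : ℕ) :
    (∏ j ∈ Finset.range (n + 1), (1 + K * εU j) ^ p) - 1 ≤ Real.exp ((p : ℝ) * (K * α / (1 - r))) - 1 := by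
  have h1r : 0 < 1 - r := by linarith
  have h0 : ∀ j, 0 ≤ 1 + K * εU j := fun j => by have := mul_nonneg hK (hεU j); linarith
  -- per factor `(1 + Kε_j)^p ≤ exp(p·Kε_j)`, then `Π exp = exp Σ`
  have hprod : ∏ j ∈ Finset.range (n + 1), (1 + K * εU j) ^ p ≤ Real.exp (∑ j ∈ Finset.range (n + 1), (p : ℝ) * (K * εU j)) := by
    rw [Real.exp_sum]
    refine Finset.prod_le_prod (fun j _ => pow_nonneg (h0 j) p) fun j _ => ?_
    rw [Real.exp_nat_mul]
    exact pow_le_pow_left₀ (h0 j) (by linarith [Real.add_one_le_exp (K * εU j)]) p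
  -- the geometric sum `Σ_{j≤n} ε_j ≤ α/(1−r)`
  have hg : ∑ j ∈ Finset.range (n + 1), εU j ≤ α / (1 - r) := by
    refine (Finset.sum_le_sum fun j hj => hεg j (Finset.mem_range.1 hj)).trans ?_
    rw [← Finset.mul_sum, geom_sum_eq hr1.ne, le_div_iff₀ h1r]
    have e : α * ((r ^ (n + 1) - 1) / (r - 1)) * (1 - r) = α * (1 - r ^ (n + 1)) := by
      have : r - 1 ≠ 0 := by linarith
      field_simp
      ring
    rw [e]
    nlinarith [pow_nonneg hr0 (n + 1)]
  have hS : ∑ j ∈ Finset.range (n + 1), (p : ℝ) * (K * εU j) ≤ (p : ℝ) * (K * α / (1 - r)) := by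
    rw [← Finset.mul_sum, ← Finset.mul_sum, mul_div_assoc]
    exact mul_le_mul_of_nonneg_left (mul_le_mul_of_nonneg_left hg hK) (Nat.cast_nonneg p)
  linarith [hprod.trans (Real.exp_le_exp.2 hS)]

include hRS hMφ hMφ' hφ hφ' ha' hα hUb hUε hεU hLε hLb in
/-- **… UNDER THE GEOMETRIC PROFILE `ε_j ≤ αr^j`: FREE OF THE NUMBER OF LEVELS** — on the diagonal `ηL^{n+1} = 1`, `c₀(L^{n+1})^d = c₁`, with
`ρ⋆ := exp(d(L−1)·Kα∕(1−r)) − 1` (`K = 2M_φM_φ′`): `(1∕(2 + 2∕a′) − (√d·Kα + (√d·Kα)² + a′ρ⋆(2 + ρ⋆)))·(‖D_1λ‖² + ‖λ‖²) ≤ re⟨λ, Δ′_{a′,k}(U)λ⟩` —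
a closed function of `(d, a′, K, L, r, α)`, the same for every height `n`, every period `m`, every `η` on the diagonal.
[cite: Balaban1985BackgroundPropagators, (3.24) p.394, (3.35)–(3.37) p.396, (3.79)–(3.81) p.406, Thm 3.11 p.416] -/
theorem strong_site_coercive_tower_diagonal_geometric (hηL : η * (L : ℝ) ^ (n + 1) = 1) (hw : c₀ * ((L : ℝ) ^ (n + 1)) ^ d = c₁)
    {r : ℝ} (hr0 : 0 ≤ r) (hr1 : r < 1) (hεg : ∀ j < n + 1, εU j ≤ α * r ^ j) (lam : SiteL2K ℂ d (towerP L m (n + 1)) c₀ W) :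
    (1 / (2 + 2 / a') -
        (Real.sqrt d * (2 * Mφ * Mφ') * α + (Real.sqrt d * (2 * Mφ * Mφ') * α) ^ 2 +
          a' * (Real.exp (((d * (L - 1) : ℕ) : ℝ) * (2 * Mφ * Mφ' * α / (1 - r))) - 1) *
            (2 + (Real.exp (((d * (L - 1) : ℕ) : ℝ) * (2 * Mφ * Mφ' * α / (1 - r))) - 1)))) *
        (‖covDerivL2K ℂ c₀ ((η : ℂ))⁻¹ (adTransportW φ (fun _ : Bond d (towerP L m (n + 1)) => (1 : 𝔸ˣ))) lam‖ ^ 2 + ‖lam‖ ^ 2) ≤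
      RCLike.re ⟪lam, laplacePrimeAk L m n φ η U a' (c₁ := c₁) lam⟫_ℂ := by
  have key := strong_site_coercive_tower_diagonal L m n φ c₀ η c₁ U hRS hMφ hMφ' hφ hφ' ha' hα hUb hUε εU hεU hLε hLb hηL hw lam
  have hK : 0 ≤ 2 * Mφ * Mφ' := by positivity
  have hρ0 := rhoTower_nonneg n hK εU hεU (d * (L - 1))
  have hρle := rhoTower_le_exp_sub_one n hK hr0 hr1 hα εU hεU hεg (d * (L - 1))
  have hE0 : 0 ≤ ‖covDerivL2K ℂ c₀ ((η : ℂ))⁻¹ (adTransportW φ (fun _ : Bond d (towerP L m (n + 1)) => (1 : 𝔸ˣ))) lam‖ ^ 2 + ‖lam‖ ^ 2 := by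
    positivity
  set ρ : ℝ := (∏ j ∈ Finset.range (n + 1), (1 + 2 * Mφ * Mφ' * εU j) ^ (d * (L - 1))) - 1 with hρdef
  set ρs : ℝ := Real.exp (((d * (L - 1) : ℕ) : ℝ) * (2 * Mφ * Mφ' * α / (1 - r))) - 1 with hρsdef
  have hmono : a' * ρ * (2 + ρ) ≤ a' * ρs * (2 + ρs) := by
    have := mul_le_mul_of_nonneg_left (show ρ * (2 + ρ) ≤ ρs * (2 + ρs) by nlinarith) ha'.le
    linarith
  linarith [key, mul_le_mul_of_nonneg_right hmono hE0]

include hRS hMφ hMφ' hφ hφ' ha' hα hUb hUε hεU hLε hLb in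
/-- **THE `‖λ‖²`-ROW READING** of the geometric-profile diagonal form: `(1∕(2 + 2∕a′) − θ⋆(α))·‖λ‖² ≤ re⟨λ, Δ′_{a′,k}(U)λ⟩` whenever
`θ⋆(α) ≤ 1∕(2+2∕a′)` (gradient row dropped). [cite: Balaban1985BackgroundPropagators, Thm 3.11 p.416, (3.24) p.394] -/
theorem coercive_laplacePrimeAk_diagonal_geometric (hηL : η * (L : ℝ) ^ (n + 1) = 1) (hw : c₀ * ((L : ℝ) ^ (n + 1)) ^ d = c₁)
    {r : ℝ} (hr0 : 0 ≤ r) (hr1 : r < 1) (hεg : ∀ j < n + 1, εU j ≤ α * r ^ j)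
    (hwin : Real.sqrt d * (2 * Mφ * Mφ') * α + (Real.sqrt d * (2 * Mφ * Mφ') * α) ^ 2 +
          a' * (Real.exp (((d * (L - 1) : ℕ) : ℝ) * (2 * Mφ * Mφ' * α / (1 - r))) - 1) *
            (2 + (Real.exp (((d * (L - 1) : ℕ) : ℝ) * (2 * Mφ * Mφ' * α / (1 - r))) - 1)) ≤ 1 / (2 + 2 / a'))
    (lam : SiteL2K ℂ d (towerP L m (n + 1)) c₀ W) :
    (1 / (2 + 2 / a') -
        (Real.sqrt d * (2 * Mφ * Mφ') * α + (Real.sqrt d * (2 * Mφ * Mφ') * α) ^ 2 +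
          a' * (Real.exp (((d * (L - 1) : ℕ) : ℝ) * (2 * Mφ * Mφ' * α / (1 - r))) - 1) *
            (2 + (Real.exp (((d * (L - 1) : ℕ) : ℝ) * (2 * Mφ * Mφ' * α / (1 - r))) - 1)))) * ‖lam‖ ^ 2 ≤
      RCLike.re ⟪lam, laplacePrimeAk L m n φ η U a' (c₁ := c₁) lam⟫_ℂ := by
  have key := strong_site_coercive_tower_diagonal_geometric L m n φ c₀ η c₁ U hRS hMφ hMφ' hφ hφ' ha' hα hUb hUε εU hεU hLε hLb hηL hw
    hr0 hr1 hεg lam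
  have hD0 : 0 ≤ ‖covDerivL2K ℂ c₀ ((η : ℂ))⁻¹ (adTransportW φ (fun _ : Bond d (towerP L m (n + 1)) => (1 : 𝔸ˣ))) lam‖ ^ 2 := sq_nonneg _
  nlinarith [key, mul_nonneg (sub_nonneg.2 hwin) hD0]

include hRS hMφ hMφ' hφ hφ' ha' hα hUb hUε hεU hLε hLb in
/-- **`Δ′_{a′,k}(U)` IS POSITIVE DEFINITE IN THE WINDOW `θ⋆(α) < 1∕(2+2∕a′)`** on the diagonal under the geometric profile — the `hpos′` slot of
`B9Eq324DeltaPrimeATower.GpOfUk` (print's «G′ = (Δ′_a)⁻¹ … positive definite», Thm 3.11) DISCHARGED at every height by a level-free condition on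
`(d, a′, K, L, r, α)` (the owner's `laplacePrimeAk_pos_of_coercive'`). [cite: Balaban1985BackgroundPropagators, Thm 3.11 p.416, (3.25) p.394] -/
theorem laplacePrimeAk_pos_diagonal_geometric (hηL : η * (L : ℝ) ^ (n + 1) = 1) (hw : c₀ * ((L : ℝ) ^ (n + 1)) ^ d = c₁)
    {r : ℝ} (hr0 : 0 ≤ r) (hr1 : r < 1) (hεg : ∀ j < n + 1, εU j ≤ α * r ^ j)
    (hwin : Real.sqrt d * (2 * Mφ * Mφ') * α + (Real.sqrt d * (2 * Mφ * Mφ') * α) ^ 2 +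
          a' * (Real.exp (((d * (L - 1) : ℕ) : ℝ) * (2 * Mφ * Mφ' * α / (1 - r))) - 1) *
            (2 + (Real.exp (((d * (L - 1) : ℕ) : ℝ) * (2 * Mφ * Mφ' * α / (1 - r))) - 1)) < 1 / (2 + 2 / a'))
    (x : SiteL2K ℂ d (towerP L m (n + 1)) c₀ W) (hx : x ≠ 0) :
    0 < RCLike.re ⟪x, laplacePrimeAk L m n φ η U a' (c₁ := c₁) x⟫_ℂ :=
  laplacePrimeAk_pos_of_coercive' L m n φ η U a' (sub_pos.2 hwin)
    (coercive_laplacePrimeAk_diagonal_geometric L m n φ c₀ η c₁ U hRS hMφ hMφ' hφ hφ' ha' hα hUb hUε εU hεU hLε hLb hηL hw hr0 hr1 hεg hwin.le)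
    x hx

end Canonical

/-! ## §4 The (SC)-shape for the site operator at `k` levels: `∃ α₀ γ′ > 0` before every lattice, height, volume and background binder -/

section Exists

variable {Mφ Mφ' : ℝ} (hMφ : 0 ≤ Mφ) (hMφ' : 0 ≤ Mφ') (hφ : ∀ w, ‖φ w‖ ≤ Mφ * ‖w‖) (hφ' : ∀ X, ‖φ.symm X‖ ≤ Mφ' * ‖X‖)
  (ha' : 0 < a') {r : ℝ} (hr0 : 0 ≤ r) (hr1 : r < 1)

omit [NeZero L] in
/-- `exp y − 1 ≤ 2y` on `0 ≤ y ≤ 1` (from `exp 1 < 3` and convexity in the form `exp y ≤ 1 + y + y²` for `|y| ≤ 1`). [folklore] -/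
private theorem exp_sub_one_le_two_mul {y : ℝ} (hy0 : 0 ≤ y) (hy1 : y ≤ 1) : Real.exp y - 1 ≤ 2 * y := by
  have h := Real.abs_exp_sub_one_sub_id_le (x := y) (by rw [abs_of_nonneg hy0]; exact hy1)
  have h' : Real.exp y - 1 - y ≤ y ^ 2 := (le_abs_self _).trans h
  nlinarith

include hMφ hMφ' hφ hφ' ha' hr0 hr1 in
/-- **THE `k`-LEVEL STRONG SMALL-FIELD COERCIVITY OF THE SITE OPERATOR, `∃` BEFORE EVERY LATTICE ∕ HEIGHT ∕ VOLUME ∕ BACKGROUND BINDER, NO DISPLAYED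
LETTER**: with `K = 2M_φM_φ′`, `c = d(L−1)K∕(1−r)`, `Θ = √d·K + d·K² + 8a′c`, `γ_f = 1∕(2+2∕a′)`, the closed forms `α₀ = min(min 1 (c+1)⁻¹) (γ_f∕(2Θ+1))`,
`γ′ = γ_f∕2` give, for every height `n`, `η` on the diagonal `ηL^{n+1} = 1`, weights `c₀(L^{n+1})^d = c₁`, period `m`, background `U` (mutually adjoint
transporters, `‖U(b) − 1‖ ≤ αη`, `‖Ū^j(b) − 1‖ ≤ ε_j ≤ αr^j`, all in `U1`) and every `α ≤ α₀`: `γ′·(‖D_1λ‖² + ‖λ‖²) ≤ re⟨λ, Δ′_{a′,k}(U)λ⟩` (on `0 ≤ cα ≤ 1`: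
`exp(cα) − 1 ≤ 2cα ≤ 2`, so `θ⋆(α) ≤ Θα ≤ γ_f∕2`) — the site-operator companion of the owner's `exists_strong_coercive_tower_diagonal` (bond operator, `R`-letter
displayed there; here NO letter). [cite: Balaban1985BackgroundPropagators, Thm 3.11 p.416, (3.24)–(3.25) p.394, (3.35)–(3.37) p.396; Balaban1984PropagatorsI, (1.18) p.20] -/
theorem exists_strong_site_coercive_tower_diagonal :
    ∃ α₀ γ' : ℝ, 0 < α₀ ∧ 0 < γ' ∧ ∀ (n : ℕ) (η : ℝ), η * (L : ℝ) ^ (n + 1) = 1 →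
      ∀ (c₀ c₁ : ℝ) [Fact (0 < c₀)] [Fact (0 < c₁)], c₀ * ((L : ℝ) ^ (n + 1)) ^ d = c₁ →
      ∀ (m : Fin d → ℕ) [∀ i, NeZero (m i)] (U : Bond d (towerP L m (n + 1)) → 𝔸ˣ),
        (∀ (b : Bond d (towerP L m (n + 1))) (v u : W), ⟪adTransportW φ U b v, u⟫_ℂ = ⟪v, adTransportW φ (fun b => (U b)⁻¹) b u⟫_ℂ) →
      ∀ (α : ℝ), 0 ≤ α → α ≤ α₀ → (∀ b, U b ∈ U1 𝔸) → (∀ b, ‖(U b : 𝔸) - 1‖ ≤ α * η) →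
      ∀ (εU : ℕ → ℝ), (∀ j, 0 ≤ εU j) → (∀ j < n + 1, εU j ≤ α * r ^ j) →
        (∀ (j : ℕ) (b : Bond d (towerP L m (j + 1))), ‖(UlevOf L m (n + 1) U j b : 𝔸) - 1‖ ≤ εU j) →
        (∀ (j : ℕ) (b : Bond d (towerP L m (j + 1))), UlevOf L m (n + 1) U j b ∈ U1 𝔸) →
      ∀ lam : SiteL2K ℂ d (towerP L m (n + 1)) c₀ W,
        γ' * (‖covDerivL2K ℂ c₀ ((η : ℂ))⁻¹ (adTransportW φ (fun _ : Bond d (towerP L m (n + 1)) => (1 : 𝔸ˣ))) lam‖ ^ 2 + ‖lam‖ ^ 2) ≤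
          RCLike.re ⟪lam, laplacePrimeAk L m n φ η U a' (c₁ := c₁) lam⟫_ℂ := by
  -- the closed forms, as opaque reals with their defining equations
  have h1r : 0 < 1 - r := by linarith
  obtain ⟨K, hK0, hKdef⟩ : ∃ K : ℝ, 0 ≤ K ∧ K = 2 * Mφ * Mφ' := ⟨_, by positivity, rfl⟩
  obtain ⟨c, hc0, hcdef⟩ : ∃ c : ℝ, 0 ≤ c ∧ c = (((d * (L - 1) : ℕ) : ℝ)) * K / (1 - r) := ⟨_, by positivity, rfl⟩
  obtain ⟨γf, hγf, hγfdef⟩ : ∃ γf : ℝ, 0 < γf ∧ γf = 1 / (2 + 2 / a') := ⟨_, by positivity, rfl⟩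
  obtain ⟨Θ, hΘ0, hΘdef⟩ : ∃ Θ : ℝ, 0 ≤ Θ ∧ Θ = Real.sqrt d * K + d * K ^ 2 + 8 * a' * c := ⟨_, by positivity, rfl⟩
  refine ⟨min (min 1 (c + 1)⁻¹) (γf / (2 * Θ + 1)), γf / 2, lt_min (lt_min one_pos (by positivity)) (by positivity), by positivity, ?_⟩
  intro n η hηL c₀ c₁ _ _ hw m _ U hRS α hα0 hαle hUb hUε εU hεU hεg hLε hLb lam
  have key := strong_site_coercive_tower_diagonal_geometric L m n φ c₀ η c₁ U hRS hMφ hMφ' hφ hφ' ha' hα0 hUb hUε εU hεU hLε hLb hηL hw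
    hr0 hr1 hεg lam
  obtain ⟨ρs, hρsdef⟩ : ∃ ρs : ℝ, ρs = Real.exp (((d * (L - 1) : ℕ) : ℝ) * (2 * Mφ * Mφ' * α / (1 - r))) - 1 := ⟨_, rfl⟩
  rw [← hρsdef, ← hKdef, ← hγfdef] at key
  have hE0 : 0 ≤ ‖covDerivL2K ℂ c₀ ((η : ℂ))⁻¹ (adTransportW φ (fun _ : Bond d (towerP L m (n + 1)) => (1 : 𝔸ˣ))) lam‖ ^ 2 + ‖lam‖ ^ 2 := by
    positivity
  -- the thresholds
  have hα1 : α ≤ 1 := hαle.trans ((min_le_left _ _).trans (min_le_left _ _))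
  have hαc : α ≤ (c + 1)⁻¹ := hαle.trans ((min_le_left _ _).trans (min_le_right _ _))
  have hαΘ : α ≤ γf / (2 * Θ + 1) := hαle.trans (min_le_right _ _)
  have hy0 : 0 ≤ c * α := mul_nonneg hc0 hα0
  have hy1 : c * α ≤ 1 :=
    (mul_le_mul_of_nonneg_left hαc hc0).trans (by rw [← div_eq_mul_inv, div_le_one (by positivity)]; linarith)
  -- `ρ⋆ ≤ 2cα ≤ 2`
  have hρs0 : 0 ≤ ρs := by rw [hρsdef]; exact sub_nonneg.2 (Real.one_le_exp (by positivity))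
  have hexp : ρs ≤ 2 * (c * α) := by
    rw [hρsdef, show ((d * (L - 1) : ℕ) : ℝ) * (2 * Mφ * Mφ' * α / (1 - r)) = c * α by rw [hcdef, hKdef]; ring]
    exact exp_sub_one_le_two_mul hy0 hy1
  have hρ2 : ρs ≤ 2 := by linarith
  have hprod : a' * ρs * (2 + ρs) ≤ 8 * a' * c * α := by
    have hA : ρs * (2 + ρs) ≤ 2 * (c * α) * (2 + ρs) := mul_le_mul_of_nonneg_right hexp (by linarith)
    have hB : 2 * (c * α) * (2 + ρs) ≤ 2 * (c * α) * 4 := mul_le_mul_of_nonneg_left (by linarith) (by positivity)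
    linarith [mul_le_mul_of_nonneg_left (hA.trans hB) ha'.le, show a' * (ρs * (2 + ρs)) = a' * ρs * (2 + ρs) by ring,
      show a' * (2 * (c * α) * 4) = 8 * a' * c * α by ring]
  -- `θ⋆(α) ≤ Θα ≤ γ_f/2`
  have hsq : (Real.sqrt d * K * α) ^ 2 ≤ d * K ^ 2 * α := by
    rw [show (Real.sqrt d * K * α) ^ 2 = d * K ^ 2 * α ^ 2 by rw [mul_pow, mul_pow, Real.sq_sqrt (Nat.cast_nonneg d)]]
    exact mul_le_mul_of_nonneg_left (show α ^ 2 ≤ α by nlinarith) (by positivity)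
  have hθ : Real.sqrt d * K * α + (Real.sqrt d * K * α) ^ 2 + a' * ρs * (2 + ρs) ≤ Θ * α := by
    have e : Θ * α = Real.sqrt d * K * α + d * K ^ 2 * α + 8 * a' * c * α := by rw [hΘdef]; ring
    rw [e]; linarith [hsq, hprod]
  have hΘα : Θ * α ≤ γf / 2 := by
    have h := mul_le_mul_of_nonneg_left hαΘ hΘ0
    have h2 : Θ * (γf / (2 * Θ + 1)) ≤ γf / 2 := by
      rw [mul_div_assoc', div_le_div_iff₀ (by positivity) (by positivity)]
      nlinarith [hγf.le, hΘ0]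
    exact h.trans h2
  have hcoef : γf / 2 ≤ γf - (Real.sqrt d * K * α + (Real.sqrt d * K * α) ^ 2 + a' * ρs * (2 + ρs)) := by
    linarith [hθ, hΘα]
  exact (mul_le_mul_of_nonneg_right hcoef hE0).trans key

end Exists

end Literature.MathematicalPhysics.QuantumFieldTheory.Balaban1983to89.B9Thm311SitePrimeFormCoerciveTowerCanonical

end
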